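import Mathlib
import Literature.NumberTheory.Transcendental.SemialgebraicMapsProofs
import Summits.KontsevichZagierPeriods.KontsevichZagierPeriods.Theorems.InverseLandauTateLiftingIsotropySpaceAux
import Summits.KontsevichZagierPeriods.KontsevichZagierPeriods.Theorems.InverseLandauTateLiftingIsotropySpaceDeriv

/-!
# `TateLifting` (stmt-KontsevichZagierPeriods-9129), line `Sketch` — stub 53 `IsotropySpace`,
# auxiliary file 3: the chart of the space engine — semialgebraicity, derivative, Jacobian

The chart of the space engine of hard-sphere cluster integrals (one rule-(2) move of the
Kontsevich–Zagier calculus on `(ℝ³)³ = ℝ⁹`, `Theorems/InverseLandauTateLiftingIsotropySpace.lean`) is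
`Ψ(a, b, ρ, y₃, y₄) = (ρ ω(a,b), M(a,b) y₃, M(a,b) y₄)` with `ω = (p, q, t)` the inverse
stereographic direction and `M = (e, g, p; g, f, q; p, q, t)` the rational rotation frame
(`…IsotropySpaceAux.lean`). Here: `Ψ` is a `ℚ`-semialgebraic map (`chart_isSemialgebraicMapOn`: nine
rational coordinates with denominator `1 + a² + b²`), it is differentiable with derivative the block
Jacobian `Ψ′ = (A, 0; C, M ⊕ M)` (`chart_hasFDerivAt`, from the partials of `…IsotropySpaceDeriv.lean`),
and `det Ψ′ = 4ρ²/(1 + a² + b²)²` (`chart_det`). The frame functions, their partials, `Ψ` and `Ψ′` are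
section variables constrained by defining equations; no definitions (pure proof file).
References: M. Kontsevich, D. Zagier, *Periods* (2001), §1.2 rule (2); J. Bochnak, M. Coste, M.-F. Roy,
*Real Algebraic Geometry* (1998), §2.2; folklore calculus.
-/

noncomputable section

open Set
open Literature.NumberTheory.Transcendental
open Literature.ModelTheory.ExponentialFields (IsSemialgebraic)

namespace Summit.KontsevichZagierPeriods.InverseLandau

namespace IsotropySpace

open MvPolynomial (aeval X C)

section Chart

variable {p q t e f g : ℝ → ℝ → ℝ}
  (hp : ∀ a b, p a b = 2 * a / (1 + a ^ 2 + b ^ 2))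
  (hq : ∀ a b, q a b = 2 * b / (1 + a ^ 2 + b ^ 2))
  (ht : ∀ a b, t a b = (1 - a ^ 2 - b ^ 2) / (1 + a ^ 2 + b ^ 2))
  (he : ∀ a b, e a b = (a ^ 2 - b ^ 2 - 1) / (1 + a ^ 2 + b ^ 2))
  (hf : ∀ a b, f a b = (b ^ 2 - a ^ 2 - 1) / (1 + a ^ 2 + b ^ 2))
  (hg : ∀ a b, g a b = 2 * a * b / (1 + a ^ 2 + b ^ 2))
variable {pa pb qa qb ta tb ea eb fa fb ga gb : ℝ → ℝ → ℝ}
  (hpa : ∀ a b, pa a b = (2 + 2 * b ^ 2 - 2 * a ^ 2) / (1 + a ^ 2 + b ^ 2) ^ 2)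
  (hpb : ∀ a b, pb a b = -(4 * a * b) / (1 + a ^ 2 + b ^ 2) ^ 2)
  (hqa : ∀ a b, qa a b = -(4 * a * b) / (1 + a ^ 2 + b ^ 2) ^ 2)
  (hqb : ∀ a b, qb a b = (2 + 2 * a ^ 2 - 2 * b ^ 2) / (1 + a ^ 2 + b ^ 2) ^ 2)
  (hta : ∀ a b, ta a b = -(4 * a) / (1 + a ^ 2 + b ^ 2) ^ 2)
  (htb : ∀ a b, tb a b = -(4 * b) / (1 + a ^ 2 + b ^ 2) ^ 2)
  (hea : ∀ a b, ea a b = 4 * a * (1 + b ^ 2) / (1 + a ^ 2 + b ^ 2) ^ 2)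
  (heb : ∀ a b, eb a b = -(4 * a ^ 2 * b) / (1 + a ^ 2 + b ^ 2) ^ 2)
  (hfa : ∀ a b, fa a b = -(4 * a * b ^ 2) / (1 + a ^ 2 + b ^ 2) ^ 2)
  (hfb : ∀ a b, fb a b = 4 * b * (1 + a ^ 2) / (1 + a ^ 2 + b ^ 2) ^ 2)
  (hga : ∀ a b, ga a b = 2 * b * (1 + b ^ 2 - a ^ 2) / (1 + a ^ 2 + b ^ 2) ^ 2)
  (hgb : ∀ a b, gb a b = 2 * a * (1 + a ^ 2 - b ^ 2) / (1 + a ^ 2 + b ^ 2) ^ 2)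

/-! ### The chart `Ψ(a, b, ρ, y₃, y₄) = (ρ ω, M y₃, M y₄)` and its Jacobian -/

variable {Ψ : (Fin 9 → ℝ) → Fin 9 → ℝ}
  (hΨ : ∀ w, Ψ w = ![w 2 * p (w 0) (w 1), w 2 * q (w 0) (w 1), w 2 * t (w 0) (w 1),
    e (w 0) (w 1) * w 3 + g (w 0) (w 1) * w 4 + p (w 0) (w 1) * w 5,
    g (w 0) (w 1) * w 3 + f (w 0) (w 1) * w 4 + q (w 0) (w 1) * w 5,
    p (w 0) (w 1) * w 3 + q (w 0) (w 1) * w 4 + t (w 0) (w 1) * w 5,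
    e (w 0) (w 1) * w 6 + g (w 0) (w 1) * w 7 + p (w 0) (w 1) * w 8,
    g (w 0) (w 1) * w 6 + f (w 0) (w 1) * w 7 + q (w 0) (w 1) * w 8,
    p (w 0) (w 1) * w 6 + q (w 0) (w 1) * w 7 + t (w 0) (w 1) * w 8])
  {Ψ' : (Fin 9 → ℝ) → (Fin 9 → ℝ) →L[ℝ] (Fin 9 → ℝ)}
  (hΨ' : ∀ x, Ψ' x = LinearMap.toContinuousLinearMap (Matrix.toLin'
    (Matrix.reindex finSumFinEquiv finSumFinEquiv
      (Matrix.fromBlocks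
        !![x 2 * pa (x 0) (x 1), x 2 * pb (x 0) (x 1), p (x 0) (x 1);
           x 2 * qa (x 0) (x 1), x 2 * qb (x 0) (x 1), q (x 0) (x 1);
           x 2 * ta (x 0) (x 1), x 2 * tb (x 0) (x 1), t (x 0) (x 1)]
        0
        !![ea (x 0) (x 1) * x 3 + ga (x 0) (x 1) * x 4 + pa (x 0) (x 1) * x 5,
             eb (x 0) (x 1) * x 3 + gb (x 0) (x 1) * x 4 + pb (x 0) (x 1) * x 5, 0;
           ga (x 0) (x 1) * x 3 + fa (x 0) (x 1) * x 4 + qa (x 0) (x 1) * x 5,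
             gb (x 0) (x 1) * x 3 + fb (x 0) (x 1) * x 4 + qb (x 0) (x 1) * x 5, 0;
           pa (x 0) (x 1) * x 3 + qa (x 0) (x 1) * x 4 + ta (x 0) (x 1) * x 5,
             pb (x 0) (x 1) * x 3 + qb (x 0) (x 1) * x 4 + tb (x 0) (x 1) * x 5, 0;
           ea (x 0) (x 1) * x 6 + ga (x 0) (x 1) * x 7 + pa (x 0) (x 1) * x 8,
             eb (x 0) (x 1) * x 6 + gb (x 0) (x 1) * x 7 + pb (x 0) (x 1) * x 8, 0;
           ga (x 0) (x 1) * x 6 + fa (x 0) (x 1) * x 7 + qa (x 0) (x 1) * x 8,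
             gb (x 0) (x 1) * x 6 + fb (x 0) (x 1) * x 7 + qb (x 0) (x 1) * x 8, 0;
           pa (x 0) (x 1) * x 6 + qa (x 0) (x 1) * x 7 + ta (x 0) (x 1) * x 8,
             pb (x 0) (x 1) * x 6 + qb (x 0) (x 1) * x 7 + tb (x 0) (x 1) * x 8, 0]
        (Matrix.reindex finSumFinEquiv finSumFinEquiv
          (Matrix.fromBlocks
            !![e (x 0) (x 1), g (x 0) (x 1), p (x 0) (x 1);
               g (x 0) (x 1), f (x 0) (x 1), q (x 0) (x 1);
               p (x 0) (x 1), q (x 0) (x 1), t (x 0) (x 1)]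
            0 0
            !![e (x 0) (x 1), g (x 0) (x 1), p (x 0) (x 1);
               g (x 0) (x 1), f (x 0) (x 1), q (x 0) (x 1);
               p (x 0) (x 1), q (x 0) (x 1), t (x 0) (x 1)]))) : Matrix (Fin 9) (Fin 9) ℝ)))

include hp hq ht he hf hg hΨ in
/-- The chart is a `ℚ`-semialgebraic map on every `ℚ`-semialgebraic set: each coordinate is a
rational function with denominator `1 + a² + b² ≠ 0`. [cite: BCR1998, §2.2] -/
theorem chart_isSemialgebraicMapOn {D : Set (Fin 9 → ℝ)} (hD : IsSemialgebraic ℚ D) :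
    IsSemialgebraicMapOn ℚ D Ψ := by
  have hQ : ∀ x ∈ D, aeval x (1 + X 0 ^ 2 + X 1 ^ 2 : MvPolynomial (Fin 9) ℚ) ≠ 0 := fun x _ => by
    simp only [map_add, map_one, map_pow, MvPolynomial.aeval_X]
    positivity
  refine IsSemialgebraicMapOn.of_forall hD fun j => ?_
  fin_cases j
  · refine (isSemialgebraicFunOn_aeval_div_aeval hD (X 2 * (2 * X 0)) (1 + X 0 ^ 2 + X 1 ^ 2) hQ).congr
      fun x _ => ?_
    simp only [hΨ, hp, map_mul, map_add, map_one, map_pow, map_ofNat, MvPolynomial.aeval_X,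
      Matrix.cons_val, Fin.reduceFinMk]
    ring
  · refine (isSemialgebraicFunOn_aeval_div_aeval hD (X 2 * (2 * X 1)) (1 + X 0 ^ 2 + X 1 ^ 2) hQ).congr
      fun x _ => ?_
    simp only [hΨ, hq, map_mul, map_add, map_one, map_pow, map_ofNat, MvPolynomial.aeval_X,
      Matrix.cons_val, Fin.reduceFinMk]
    ring
  · refine (isSemialgebraicFunOn_aeval_div_aeval hD (X 2 * (1 - X 0 ^ 2 - X 1 ^ 2))
      (1 + X 0 ^ 2 + X 1 ^ 2) hQ).congr fun x _ => ?_
    simp only [hΨ, ht, map_mul, map_sub, map_add, map_one, map_pow, MvPolynomial.aeval_X,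
      Matrix.cons_val, Fin.reduceFinMk]
    ring
  · refine (isSemialgebraicFunOn_aeval_div_aeval hD
      ((X 0 ^ 2 - X 1 ^ 2 - 1) * X 3 + 2 * X 0 * X 1 * X 4 + 2 * X 0 * X 5)
      (1 + X 0 ^ 2 + X 1 ^ 2) hQ).congr fun x _ => ?_
    simp only [hΨ, he, hg, hp, map_mul, map_sub, map_add, map_one, map_pow, map_ofNat,
      MvPolynomial.aeval_X, Matrix.cons_val, Fin.reduceFinMk]
    ring
  · refine (isSemialgebraicFunOn_aeval_div_aeval hD
      (2 * X 0 * X 1 * X 3 + (X 1 ^ 2 - X 0 ^ 2 - 1) * X 4 + 2 * X 1 * X 5)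
      (1 + X 0 ^ 2 + X 1 ^ 2) hQ).congr fun x _ => ?_
    simp only [hΨ, hg, hf, hq, map_mul, map_sub, map_add, map_one, map_pow, map_ofNat,
      MvPolynomial.aeval_X, Matrix.cons_val, Fin.reduceFinMk]
    ring
  · refine (isSemialgebraicFunOn_aeval_div_aeval hD
      (2 * X 0 * X 3 + 2 * X 1 * X 4 + (1 - X 0 ^ 2 - X 1 ^ 2) * X 5)
      (1 + X 0 ^ 2 + X 1 ^ 2) hQ).congr fun x _ => ?_
    simp only [hΨ, hp, hq, ht, map_mul, map_sub, map_add, map_one, map_pow, map_ofNat,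
      MvPolynomial.aeval_X, Matrix.cons_val, Fin.reduceFinMk]
    ring
  · refine (isSemialgebraicFunOn_aeval_div_aeval hD
      ((X 0 ^ 2 - X 1 ^ 2 - 1) * X 6 + 2 * X 0 * X 1 * X 7 + 2 * X 0 * X 8)
      (1 + X 0 ^ 2 + X 1 ^ 2) hQ).congr fun x _ => ?_
    simp only [hΨ, he, hg, hp, map_mul, map_sub, map_add, map_one, map_pow, map_ofNat,
      MvPolynomial.aeval_X, Matrix.cons_val, Fin.reduceFinMk]
    ring
  · refine (isSemialgebraicFunOn_aeval_div_aeval hD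
      (2 * X 0 * X 1 * X 6 + (X 1 ^ 2 - X 0 ^ 2 - 1) * X 7 + 2 * X 1 * X 8)
      (1 + X 0 ^ 2 + X 1 ^ 2) hQ).congr fun x _ => ?_
    simp only [hΨ, hg, hf, hq, map_mul, map_sub, map_add, map_one, map_pow, map_ofNat,
      MvPolynomial.aeval_X, Matrix.cons_val, Fin.reduceFinMk]
    ring
  · refine (isSemialgebraicFunOn_aeval_div_aeval hD
      (2 * X 0 * X 6 + 2 * X 1 * X 7 + (1 - X 0 ^ 2 - X 1 ^ 2) * X 8)
      (1 + X 0 ^ 2 + X 1 ^ 2) hQ).congr fun x _ => ?_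
    simp only [hΨ, hp, hq, ht, map_mul, map_sub, map_add, map_one, map_pow, map_ofNat,
      MvPolynomial.aeval_X, Matrix.cons_val, Fin.reduceFinMk]
    ring

include hp hq ht he hf hg hpa hpb hqa hqb hta htb hea heb hfa hfb hga hgb hΨ hΨ' in
/-- The chart is differentiable, with derivative the block Jacobian `Ψ′`. [folklore] -/
theorem chart_hasFDerivAt (x : Fin 9 → ℝ) : HasFDerivAt Ψ (Ψ' x) x := by
  have hP : ∀ i : Fin 9, HasFDerivAt (fun w : Fin 9 → ℝ => w i)
      (ContinuousLinearMap.proj (R := ℝ) (φ := fun _ : Fin 9 => ℝ) i) x :=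
    fun i => hasFDerivAt_apply i x
  have Hp := hasFDerivAt_p hp hpa hpb x
  have Hq := hasFDerivAt_q hq hqa hqb x
  have Ht := hasFDerivAt_t ht hta htb x
  have He := hasFDerivAt_e he hea heb x
  have Hf := hasFDerivAt_f hf hfa hfb x
  have Hg := hasFDerivAt_g hg hga hgb x
  rw [show Ψ = fun w => ![w 2 * p (w 0) (w 1), w 2 * q (w 0) (w 1), w 2 * t (w 0) (w 1),
    e (w 0) (w 1) * w 3 + g (w 0) (w 1) * w 4 + p (w 0) (w 1) * w 5,
    g (w 0) (w 1) * w 3 + f (w 0) (w 1) * w 4 + q (w 0) (w 1) * w 5,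
    p (w 0) (w 1) * w 3 + q (w 0) (w 1) * w 4 + t (w 0) (w 1) * w 5,
    e (w 0) (w 1) * w 6 + g (w 0) (w 1) * w 7 + p (w 0) (w 1) * w 8,
    g (w 0) (w 1) * w 6 + f (w 0) (w 1) * w 7 + q (w 0) (w 1) * w 8,
    p (w 0) (w 1) * w 6 + q (w 0) (w 1) * w 7 + t (w 0) (w 1) * w 8] from funext hΨ, hΨ',
    hasFDerivAt_pi']
  intro i
  fin_cases i
  · show HasFDerivAt (fun w : Fin 9 → ℝ => w 2 * p (w 0) (w 1)) _ x
    refine ((hP 2).mul Hp).congr_fderiv (ContinuousLinearMap.ext fun v => ?_)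
    simp only [_root_.add_apply, _root_.smul_apply, ContinuousLinearMap.coe_comp, Function.comp_apply,
      ContinuousLinearMap.proj_apply, LinearMap.coe_toContinuousLinearMap', Matrix.toLin'_apply,
      blockJac_mulVec, smul_eq_mul, Matrix.of_apply, Matrix.cons_val', Matrix.cons_val,
      Matrix.empty_val', Matrix.cons_val_fin_one, Fin.reduceFinMk]
    ring
  · show HasFDerivAt (fun w : Fin 9 → ℝ => w 2 * q (w 0) (w 1)) _ x
    refine ((hP 2).mul Hq).congr_fderiv (ContinuousLinearMap.ext fun v => ?_)
    simp only [_root_.add_apply, _root_.smul_apply, ContinuousLinearMap.coe_comp, Function.comp_apply,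
      ContinuousLinearMap.proj_apply, LinearMap.coe_toContinuousLinearMap', Matrix.toLin'_apply,
      blockJac_mulVec, smul_eq_mul, Matrix.of_apply, Matrix.cons_val', Matrix.cons_val,
      Matrix.empty_val', Matrix.cons_val_fin_one, Fin.reduceFinMk]
    ring
  · show HasFDerivAt (fun w : Fin 9 → ℝ => w 2 * t (w 0) (w 1)) _ x
    refine ((hP 2).mul Ht).congr_fderiv (ContinuousLinearMap.ext fun v => ?_)
    simp only [_root_.add_apply, _root_.smul_apply, ContinuousLinearMap.coe_comp, Function.comp_apply,
      ContinuousLinearMap.proj_apply, LinearMap.coe_toContinuousLinearMap', Matrix.toLin'_apply,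
      blockJac_mulVec, smul_eq_mul, Matrix.of_apply, Matrix.cons_val', Matrix.cons_val,
      Matrix.empty_val', Matrix.cons_val_fin_one, Fin.reduceFinMk]
    ring
  · show HasFDerivAt (fun w : Fin 9 → ℝ =>
      e (w 0) (w 1) * w 3 + g (w 0) (w 1) * w 4 + p (w 0) (w 1) * w 5) _ x
    refine (((He.mul (hP 3)).add (Hg.mul (hP 4))).add (Hp.mul (hP 5))).congr_fderiv
      (ContinuousLinearMap.ext fun v => ?_)
    simp only [_root_.add_apply, _root_.smul_apply, ContinuousLinearMap.coe_comp, Function.comp_apply,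
      ContinuousLinearMap.proj_apply, LinearMap.coe_toContinuousLinearMap', Matrix.toLin'_apply,
      blockJac_mulVec, smul_eq_mul, Matrix.of_apply, Matrix.cons_val', Matrix.cons_val,
      Matrix.empty_val', Matrix.cons_val_fin_one, Fin.reduceFinMk]
    ring
  · show HasFDerivAt (fun w : Fin 9 → ℝ =>
      g (w 0) (w 1) * w 3 + f (w 0) (w 1) * w 4 + q (w 0) (w 1) * w 5) _ x
    refine (((Hg.mul (hP 3)).add (Hf.mul (hP 4))).add (Hq.mul (hP 5))).congr_fderiv
      (ContinuousLinearMap.ext fun v => ?_)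
    simp only [_root_.add_apply, _root_.smul_apply, ContinuousLinearMap.coe_comp, Function.comp_apply,
      ContinuousLinearMap.proj_apply, LinearMap.coe_toContinuousLinearMap', Matrix.toLin'_apply,
      blockJac_mulVec, smul_eq_mul, Matrix.of_apply, Matrix.cons_val', Matrix.cons_val,
      Matrix.empty_val', Matrix.cons_val_fin_one, Fin.reduceFinMk]
    ring
  · show HasFDerivAt (fun w : Fin 9 → ℝ =>
      p (w 0) (w 1) * w 3 + q (w 0) (w 1) * w 4 + t (w 0) (w 1) * w 5) _ x
    refine (((Hp.mul (hP 3)).add (Hq.mul (hP 4))).add (Ht.mul (hP 5))).congr_fderiv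
      (ContinuousLinearMap.ext fun v => ?_)
    simp only [_root_.add_apply, _root_.smul_apply, ContinuousLinearMap.coe_comp, Function.comp_apply,
      ContinuousLinearMap.proj_apply, LinearMap.coe_toContinuousLinearMap', Matrix.toLin'_apply,
      blockJac_mulVec, smul_eq_mul, Matrix.of_apply, Matrix.cons_val', Matrix.cons_val,
      Matrix.empty_val', Matrix.cons_val_fin_one, Fin.reduceFinMk]
    ring
  · show HasFDerivAt (fun w : Fin 9 → ℝ =>
      e (w 0) (w 1) * w 6 + g (w 0) (w 1) * w 7 + p (w 0) (w 1) * w 8) _ x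
    refine (((He.mul (hP 6)).add (Hg.mul (hP 7))).add (Hp.mul (hP 8))).congr_fderiv
      (ContinuousLinearMap.ext fun v => ?_)
    simp only [_root_.add_apply, _root_.smul_apply, ContinuousLinearMap.coe_comp, Function.comp_apply,
      ContinuousLinearMap.proj_apply, LinearMap.coe_toContinuousLinearMap', Matrix.toLin'_apply,
      blockJac_mulVec, smul_eq_mul, Matrix.of_apply, Matrix.cons_val', Matrix.cons_val,
      Matrix.empty_val', Matrix.cons_val_fin_one, Fin.reduceFinMk]
    ring
  · show HasFDerivAt (fun w : Fin 9 → ℝ =>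
      g (w 0) (w 1) * w 6 + f (w 0) (w 1) * w 7 + q (w 0) (w 1) * w 8) _ x
    refine (((Hg.mul (hP 6)).add (Hf.mul (hP 7))).add (Hq.mul (hP 8))).congr_fderiv
      (ContinuousLinearMap.ext fun v => ?_)
    simp only [_root_.add_apply, _root_.smul_apply, ContinuousLinearMap.coe_comp, Function.comp_apply,
      ContinuousLinearMap.proj_apply, LinearMap.coe_toContinuousLinearMap', Matrix.toLin'_apply,
      blockJac_mulVec, smul_eq_mul, Matrix.of_apply, Matrix.cons_val', Matrix.cons_val,
      Matrix.empty_val', Matrix.cons_val_fin_one, Fin.reduceFinMk]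
    ring
  · show HasFDerivAt (fun w : Fin 9 → ℝ =>
      p (w 0) (w 1) * w 6 + q (w 0) (w 1) * w 7 + t (w 0) (w 1) * w 8) _ x
    refine (((Hp.mul (hP 6)).add (Hq.mul (hP 7))).add (Ht.mul (hP 8))).congr_fderiv
      (ContinuousLinearMap.ext fun v => ?_)
    simp only [_root_.add_apply, _root_.smul_apply, ContinuousLinearMap.coe_comp, Function.comp_apply,
      ContinuousLinearMap.proj_apply, LinearMap.coe_toContinuousLinearMap', Matrix.toLin'_apply,
      blockJac_mulVec, smul_eq_mul, Matrix.of_apply, Matrix.cons_val', Matrix.cons_val,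
      Matrix.empty_val', Matrix.cons_val_fin_one, Fin.reduceFinMk]
    ring

include hp hq ht he hf hg hpa hpb hqa hqb hta htb hΨ' in
/-- The Jacobian determinant of the chart: `det Ψ′ = 4ρ²/(1 + a² + b²)²` (`ρ = x 2`,
`(a, b) = (x 0, x 1)`). [folklore] -/
theorem chart_det (x : Fin 9 → ℝ) : (Ψ' x).det = 4 * x 2 ^ 2 / (1 + x 0 ^ 2 + x 1 ^ 2) ^ 2 := by
  rw [hΨ']
  change LinearMap.det (Matrix.toLin' (_ : Matrix (Fin 9) (Fin 9) ℝ)) = _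
  rw [LinearMap.det_toLin', det_blockJac, frame_det hp hq ht he hf hg,
    det_stereoBlock hp hq ht hpa hpb hqa hqb hta htb]
  ring

include hp hq ht he hf hg in
/-- The six orthonormality identities of the frame (unit columns, orthogonal columns). [folklore] -/
theorem frame_orthonormal (a b : ℝ) :
    e a b ^ 2 + g a b ^ 2 + p a b ^ 2 = 1 ∧ g a b ^ 2 + f a b ^ 2 + q a b ^ 2 = 1 ∧
    p a b ^ 2 + q a b ^ 2 + t a b ^ 2 = 1 ∧ e a b * g a b + g a b * f a b + p a b * q a b = 0 ∧
    e a b * p a b + g a b * q a b + p a b * t a b = 0 ∧ g a b * p a b + f a b * q a b + q a b * t a b = 0 := by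
  have h : (1 : ℝ) + a ^ 2 + b ^ 2 ≠ 0 := by positivity
  refine ⟨?_, ?_, ?_, ?_, ?_, ?_⟩ <;> simp only [hp, hq, ht, he, hf, hg] <;> field_simp <;> ring

end Chart

end IsotropySpace

/-- **Registered auxiliary sub-goal of stub 53 `IsotropySpace` (orthonormality of the rational rotation frame).**
The columns of `M(a,b) = (e, g, p; g, f, q; p, q, t)` — `e = (a²−b²−1)/D`, `f = (b²−a²−1)/D`, `g = 2ab/D`,
`(p, q, t) = (2a, 2b, 1−a²−b²)/D`, `D = 1 + a² + b²` — are orthonormal (`IsotropySpace.frame_orthonormal`). [folklore] -/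
theorem tateLifting_isotropySpaceFrameOrthonormal :
    ∀ (a b : ℝ),
      ((a ^ 2 - b ^ 2 - 1) / (1 + a ^ 2 + b ^ 2)) ^ 2 + (2 * a * b / (1 + a ^ 2 + b ^ 2)) ^ 2 +
          (2 * a / (1 + a ^ 2 + b ^ 2)) ^ 2 = 1 ∧
      (2 * a * b / (1 + a ^ 2 + b ^ 2)) ^ 2 + ((b ^ 2 - a ^ 2 - 1) / (1 + a ^ 2 + b ^ 2)) ^ 2 +
          (2 * b / (1 + a ^ 2 + b ^ 2)) ^ 2 = 1 ∧
      (2 * a / (1 + a ^ 2 + b ^ 2)) ^ 2 + (2 * b / (1 + a ^ 2 + b ^ 2)) ^ 2 +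
          ((1 - a ^ 2 - b ^ 2) / (1 + a ^ 2 + b ^ 2)) ^ 2 = 1 ∧
      (a ^ 2 - b ^ 2 - 1) / (1 + a ^ 2 + b ^ 2) * (2 * a * b / (1 + a ^ 2 + b ^ 2)) +
          2 * a * b / (1 + a ^ 2 + b ^ 2) * ((b ^ 2 - a ^ 2 - 1) / (1 + a ^ 2 + b ^ 2)) +
          2 * a / (1 + a ^ 2 + b ^ 2) * (2 * b / (1 + a ^ 2 + b ^ 2)) = 0 ∧
      (a ^ 2 - b ^ 2 - 1) / (1 + a ^ 2 + b ^ 2) * (2 * a / (1 + a ^ 2 + b ^ 2)) +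
          2 * a * b / (1 + a ^ 2 + b ^ 2) * (2 * b / (1 + a ^ 2 + b ^ 2)) +
          2 * a / (1 + a ^ 2 + b ^ 2) * ((1 - a ^ 2 - b ^ 2) / (1 + a ^ 2 + b ^ 2)) = 0 ∧
      2 * a * b / (1 + a ^ 2 + b ^ 2) * (2 * a / (1 + a ^ 2 + b ^ 2)) +
          (b ^ 2 - a ^ 2 - 1) / (1 + a ^ 2 + b ^ 2) * (2 * b / (1 + a ^ 2 + b ^ 2)) +
          2 * b / (1 + a ^ 2 + b ^ 2) * ((1 - a ^ 2 - b ^ 2) / (1 + a ^ 2 + b ^ 2)) = 0 :=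
  fun a b => IsotropySpace.frame_orthonormal (p := fun a b => 2 * a / (1 + a ^ 2 + b ^ 2))
    (q := fun a b => 2 * b / (1 + a ^ 2 + b ^ 2))
    (t := fun a b => (1 - a ^ 2 - b ^ 2) / (1 + a ^ 2 + b ^ 2))
    (e := fun a b => (a ^ 2 - b ^ 2 - 1) / (1 + a ^ 2 + b ^ 2))
    (f := fun a b => (b ^ 2 - a ^ 2 - 1) / (1 + a ^ 2 + b ^ 2))
    (g := fun a b => 2 * a * b / (1 + a ^ 2 + b ^ 2))
    (fun _ _ => rfl) (fun _ _ => rfl) (fun _ _ => rfl) (fun _ _ => rfl) (fun _ _ => rfl) (fun _ _ => rfl) a b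

end Summit.KontsevichZagierPeriods.InverseLandau

end
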